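import Mathlib
import Summits.PneNP.PneNP.Theses.AeaCutRectangles
import Summits.PneNP.PneNP.Theorems.FoolingMeasure.Negative.FoolingMeasureFalseOfHalfSparseCore

/-!
# Sketch — subgroup (cyclotomic) near-miss circulants (crux-ideate seat 1 g4, stmt-PneNP-19727 `FoolingMeasure`)

First lemmas of the idea card `cyclotomic-subgroup-circulants`.  FRONTIER restricted-model rung (AEA cut
rectangles); nothing here bears on P vs NP.

THE LEVER.  Take the connection set to be (half of) a multiplicative SUBGROUP `H ≤ (ℤ/n)ˣ` with `-1 ∈ H`:
`C(n; H) = Cay(ℤ/n, H)`.  Then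
* near-miss (all ordered ratios `≡ 2 (mod 3)`) costs `(|H| - 2)/2` residue conditions instead of `|S|(|S|-1)`;
* every `b ∈ H` of order `10` with `b^5 = -1` turns each coset `c⟨b⟩ ⊆ H` into an edge-disjoint PENTAGON SYSTEM
  for free, by the cyclotomic identity `(1+b)(1-b+b²-b³+b⁴) = 1+b⁵ = 0` (`coset_pentagon_relation` below);
  `r = |H|/10` systems give `e(T) ≥ r(5|T| - 2n)` on every vertex set, i.e. min-half `≥ r·n/2`: LINEAR EXCESS
  `(r-1)n/2` over the `HalfSparseCore` threshold as soon as `|H| ≥ 20`;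
* `NC` (no multiplier coset `tH` inside the middle third) + R3T ⇒ not 3-colourable ⇒ 4-critical.
The g3 witness `W₁ = C(5371; ±{1,332,728,1745,2567})` IS this construction with `H = ⟨332⟩` of order 10
(`w1_is_cyclotomic`).  (Self-contained: the g3 sketch `NearMissCirculantsSketch.lean` in this directory is not a built
module, so the two notions it shares with this file — `HDCTemplate`-style templates and the transfer to `¬ HalfSparseCore` — are
restated here in the `r`-fold form.)
-/

namespace Summit.PneNP.PneNP.Cruxes.FoolingMeasure.SubgroupCirculants

open Finset SimpleGraph
open Summit.PneNP.PneNP.Theorems.AeaCutRectanglesDutyRectangles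
open Summit.PneNP.PneNP.Theorems.FoolingMeasure.Negative

/-- the cyclotomic identity behind the free pentagon relations. -/
theorem alt_sum_mul {R : Type*} [CommRing R] (b : R) :
    (1 + b) * (1 - b + b ^ 2 - b ^ 3 + b ^ 4) = 1 + b ^ 5 := by ring

/-- FIRST LEMMA (proved): if `b⁵ = -1` and `1 + b` is a unit, every coset representative `c` carries the signed
zero-sum pentagon relation `c - cb + cb² - cb³ + cb⁴ = 0`; so the five classes `c, cb, cb², cb³, cb⁴` of the
circulant close up into `n` translates of a 5-cycle. -/
theorem coset_pentagon_relation {R : Type*} [CommRing R] (b c : R) (hb : b ^ 5 = -1) (hu : IsUnit (1 + b)) :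
    c - c * b + c * b ^ 2 - c * b ^ 3 + c * b ^ 4 = 0 := by
  have h : (1 + b) * (c * (1 - b + b ^ 2 - b ^ 3 + b ^ 4)) = 0 := by
    calc (1 + b) * (c * (1 - b + b ^ 2 - b ^ 3 + b ^ 4))
        = c * ((1 + b) * (1 - b + b ^ 2 - b ^ 3 + b ^ 4)) := by ring
      _ = c * (1 + b ^ 5) := by rw [alt_sum_mul]
      _ = 0 := by rw [hb]; ring
  have h' : c * (1 - b + b ^ 2 - b ^ 3 + b ^ 4) = 0 := (hu.mul_right_eq_zero).mp h
  linear_combination h'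

/-- `W₁` is cyclotomic: `332` has `332⁵ = -1` in `ℤ/5371` (`5371 = 41·131`), and its powers are the witness
classes up to sign: `332² = -2567`, `332³ = 1745`, `332⁴ = -728`. -/
theorem w1_is_cyclotomic :
    (332 : ZMod 5371) ^ 5 = -1 ∧ (332 : ZMod 5371) ^ 2 = -2567 ∧
      (332 : ZMod 5371) ^ 3 = 1745 ∧ (332 : ZMod 5371) ^ 4 = -728 := by
  refine ⟨?_, ?_, ?_, ?_⟩ <;> decide

/-- … so the g3 relation `1 - 332 - 2567 - 728 - 1745 = 0` is `coset_pentagon_relation` with `c = 1`. -/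
example : (1 : ZMod 5371) - 332 + 332 ^ 2 - 332 ^ 3 + 332 ^ 4 = 0 := by decide

/-- COSET PENTAGON BOUND (support statement; elementary double counting, the `r`-system form of
`NearMissCirculants.PentagonSystemBound`): if the connection set `S` of a circulant on `ℤ/n` (odd `n`)
contains, up to sign, `r` cosets `c⟨b⟩`-halves `{c, cb, cb², cb³, cb⁴}` (`c ∈ C`, `|C| = r`) with `b⁵ = -1`,
`1 + b` a unit, all `5r` classes pairwise distinct up to sign and nonzero, then every vertex set `T` spans at least
`r(5|T| - 2n)` edges.  At `|T| = ⌈n/2⌉` this is `r(n+5)/2`: excess `((r-1)n + 5r)/2` over the `HalfSparseCore`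
threshold `n/2`. -/
def CosetPentagonBound : Prop :=
  ∀ (n : ℕ) [NeZero n], Odd n → ∀ (S C : Finset (ZMod n)) (b : ZMod n), b ^ 5 = -1 → IsUnit (1 + b) →
    (0 : ZMod n) ∉ S →
    (∀ c ∈ C, ∀ m < 5, c * b ^ m ∈ S ∨ -(c * b ^ m) ∈ S) →
    (∀ c ∈ C, ∀ c' ∈ C, ∀ m < 5, ∀ m' < 5,
        (c * b ^ m = c' * b ^ m' ∨ c * b ^ m = -(c' * b ^ m')) → c = c' ∧ m = m') →
    ∀ T : Finset (ZMod n),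
      (C.card : ℤ) * (5 * (T.card : ℤ) - 2 * n)
        ≤ ((bobSide T (circulantGraph (S : Set (ZMod n))).edgeFinset).card : ℤ)


/-- An `r`-FOLD HALF-DENSE 4-CRITICAL TEMPLATE: a loopless, non-3-colourable, edge-critical edge set on `Fin n` every
`≥ n/2`-vertex set of which spans MORE THAN `r·n/2` edges (`r = 1` is the g3 notion `HDCTemplate`; `r = 2` is LINEAR
EXCESS `n/2` over the `HalfSparseCore` threshold). -/
def ExcessTemplate (r : ℕ) : Prop :=
  ∃ (n : ℕ) (G : Finset (Sym2 (Fin n))), (∀ e ∈ G, ¬ e.IsDiag) ∧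
    ¬ (fromEdgeSet (G : Set (Sym2 (Fin n)))).Colorable 3 ∧
    (∀ F, F ⊆ G → ¬ (fromEdgeSet (F : Set (Sym2 (Fin n)))).Colorable 3 → F = G) ∧
    ∀ T : Finset (Fin n), n ≤ 2 * T.card → r * n < 2 * (bobSide T G).card

theorem excessTemplate_mono {r r' : ℕ} (h : r ≤ r') (hr : ExcessTemplate r') : ExcessTemplate r := by
  obtain ⟨n, G, h1, h2, h3, h4⟩ := hr
  refine ⟨n, G, h1, h2, h3, fun T hT => ?_⟩
  have := h4 T hT
  have : r * n ≤ r' * n := Nat.mul_le_mul_right n h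
  omega

/-- TRANSFER (proved): a `1`-fold template already refutes `HalfSparseCore`, the hypothesis of the standing
conditional kill `foolingMeasure_false_of_halfSparseCore` (p570033); an `r`-fold one does so with room `(r-1)n/2`. -/
theorem excessTemplate_not_halfSparseCore {r : ℕ} (hr : 1 ≤ r) (h : ExcessTemplate r) : ¬ HalfSparseCore := by
  intro hH
  obtain ⟨n, G, hloop, hcol, hcrit, hdense⟩ := excessTemplate_mono hr h
  obtain ⟨S, hS, F, hFG, hF, hFS⟩ := hH n G hloop hcol
  have hFeq : F = G := hcrit F hFG hF
  subst hFeq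
  have := hdense S hS
  omega

section CosetPairWitness
/-! ### The first linear-excess witness `W₂₀(477691)` (kit j295875; found g4)
`n = 477691 = 41·61·191 ≡ 1 (mod 3)`, `b = 380423` (`b⁵ = -1`), `c = 21890`;
`S = P ∪ cP = {1, 9557, 21890, 68225, 233915, 349958, 380423, 393569, 451763, 474101}` (least residues; as classes
up to sign `{1, 3590, 9557, 84122, 97268} ∪ {21890, 25928, 68225, 127733, 233915}`).
Checked by exact integer arithmetic (kit j295875 / local): near-miss (all 90 ordered ratios `≡ 2 (mod 3)`);
NO `t ∈ ℤ/n` (units and non-units) puts `tS` inside the middle third (so not 3-colourable, by R3T); both cosets close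
into pentagons with 5 distinct vertices and the 10 classes are pairwise distinct: `e(T) ≥ 2(5|T| - 2n)` for every `T`,
`= n + 5 = 477696` at `|T| = ⌈n/2⌉` (threshold `n/2 = 238845.5`; best arc half found: `499191`). -/

/-- modulus of the coset-pair witness. -/
abbrev Nw : ℕ := 477691

theorem Nw_factor : Nw = 41 * 61 * 191 ∧ Nw % 3 = 1 := by decide

/-- the cyclotomic generator and the coset multiplier. -/
abbrev bw : ZMod Nw := 380423
abbrev cw : ZMod Nw := 21890

/-- `b⁵ = -1`, and `1 + b` is a unit (explicit inverse), so `coset_pentagon_relation` applies to both cosets. -/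
theorem bw_pow_five : bw ^ 5 = -1 := by decide

/-- the two pentagon relations, by direct evaluation (instances of `coset_pentagon_relation` with `c = 1, cw`). -/
theorem w20_relations :
    (1 : ZMod Nw) - bw + bw ^ 2 - bw ^ 3 + bw ^ 4 = 0 ∧
      cw - cw * bw + cw * bw ^ 2 - cw * bw ^ 3 + cw * bw ^ 4 = 0 := by
  constructor <;> decide

/-- connection set (one representative per `±` class, least residues as found). -/
def w20S : Finset (ZMod Nw) := {1, 9557, 21890, 68225, 233915, 349958, 380423, 393569, 451763, 474101}

/-- the witness graph, a 20-regular circulant. -/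
abbrev w20G : SimpleGraph (ZMod Nw) := circulantGraph (w20S : Set (ZMod Nw))

/-- OBLIGATION NC (arithmetic non-colourability certificate; exhaustive scan done in kit j295875, to be replayed by a
verified enumeration or replaced by a DRAT proof): no multiplier puts the ten classes in the middle third. -/
def W20NoMiddleThird : Prop :=
  ¬ ∃ t : ZMod Nw, ∀ d ∈ w20S, Nw ≤ 3 * (t * d).val ∧ 3 * (t * d).val ≤ 2 * Nw

/-- half-density with linear excess: every vertex set of size `≥ n/2` spans `> n` edges
(`CosetPentagonBound` with `C = {1, cw}`, `b = bw`).  PROVED below: `w20LinearExcess_holds`. -/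
def W20LinearExcess : Prop :=
  ∀ T : Finset (ZMod Nw), Nw ≤ 2 * T.card → 2 * Nw < 2 * (bobSide T w20G.edgeFinset).card

end CosetPairWitness

/-- SUPPORT-DIVERSITY LOWER BOUND (kill-side bookkeeping, elementary; generalises the orbit-measure lemma p558168):
if `μ` satisfies the `FoolingMeasure` rectangle clause at ONE inside-set `B` with constant `C`, then the Bob-marginal
of every pattern `β` on `B` is at most `2^{-(n/2)·log₂ n - C n}` (take `𝓑 = {β}`, `𝓐 = {S \ S[B] : S ∈ supp μ, S[B] = β}`),
hence the support shows at least `2^{(n/2) log₂ n + C n}` distinct induced patterns on `B`; since a family of `W`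
isomorphism types induces at most `W · n^{|B|}` patterns on `B`, the support has at least
`2^{(n/2) log₂ n + C n} / n^{|B|} = n^{n/2 - |B|}·2^{Cn}` isomorphism types — `n^{εn}·2^{Cn}` at `|B| = (1/2-ε)n`.
In particular no family of `2^{O(n)}` types (all circulants / Cayley graphs on groups of order `n` included) can
support a fooling measure on its own.  Stated here for the marginal step; the counting step is bookkeeping. -/
def BobMarginalAtomBound : Prop :=
  ∀ (n : ℕ) (C : ℝ) (μ : Finset (Sym2 (Fin n)) → ℝ), (∀ S, 0 ≤ μ S) →
    (∀ S, μ S ≠ 0 → (∀ e ∈ S, ¬ e.IsDiag) ∧ ¬ (fromEdgeSet (S : Set (Sym2 (Fin n)))).Colorable 3) →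
    ∀ B : Finset (Fin n),
      (∀ 𝓐 𝓑 : Finset (Finset (Sym2 (Fin n))),
        (∀ α ∈ 𝓐, ∀ e ∈ α, ¬ e.IsDiag ∧ ∃ v ∈ e, v ∉ B) →
        (∀ β ∈ 𝓑, ∀ e ∈ β, ¬ e.IsDiag ∧ ∀ v ∈ e, v ∈ B) →
        (∀ α ∈ 𝓐, ∀ β ∈ 𝓑, ¬ (fromEdgeSet ((α ∪ β : Finset (Sym2 (Fin n))) : Set (Sym2 (Fin n)))).Colorable 3) →
        ∑ q ∈ 𝓐 ×ˢ 𝓑, μ (q.1 ∪ q.2) ≤ (2 : ℝ) ^ (-((n : ℝ) / 2 * Real.logb 2 n) - C * n)) →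
      ∀ β : Finset (Sym2 (Fin n)),
        ∑ S ∈ (Finset.univ.filter fun S => μ S ≠ 0 ∧ bobSide B S = β), μ S
          ≤ (2 : ℝ) ^ (-((n : ℝ) / 2 * Real.logb 2 n) - C * n)


/-! ## Zero-sum pentagon bound — NON-ABELIAN form (g4 addendum; transplants the lever to seat 2's normal cycle systems)

Five permutations `s₀,…,s₄` of a finite vertex type whose alternating product CLOSES, `s₄ ∘ s₃⁻¹ ∘ s₂ ∘ s₁⁻¹ ∘ s₀ = 1`,
make every start vertex `x` the base of a closed 5-walk `x, s₀x, s₁⁻¹s₀x, s₂s₁⁻¹s₀x, s₃⁻¹s₂s₁⁻¹s₀x, x` using one edge of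
each class `{y, sᵢ y}`; the walks use each of the `5|V|` class edges exactly once and fill every vertex slot bijectively.
Consequently EVERY vertex set `T` spans at least `5|T| - 2|V|` class edges (no commutativity and no simplicity of the
walks needed — only that the `5|V|` class edges are pairwise distinct).  PROVED below (`zeroSum_pentagon_bound`), then
specialised to translation tuples and to the witness `W₂₀(477691)` (`w20LinearExcess_holds`). -/

section ZeroSum

variable {V : Type*} [Fintype V] [DecidableEq V]

/-- `j`-th vertex map of the closed 5-walks. -/
def wv (s : Fin 5 → Equiv.Perm V) : Fin 5 → Equiv.Perm V :=
  ![1, s 0, (s 1)⁻¹ * s 0, s 2 * ((s 1)⁻¹ * s 0), (s 3)⁻¹ * (s 2 * ((s 1)⁻¹ * s 0))]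

/-- `(j+1)`-st vertex map of the 5-walks (the walks close iff `wn s 4 = 1`). -/
def wn (s : Fin 5 → Equiv.Perm V) : Fin 5 → Equiv.Perm V :=
  ![s 0, (s 1)⁻¹ * s 0, s 2 * ((s 1)⁻¹ * s 0), (s 3)⁻¹ * (s 2 * ((s 1)⁻¹ * s 0)),
    s 4 * ((s 3)⁻¹ * (s 2 * ((s 1)⁻¹ * s 0)))]

/-- the class edges `{x, sᵢ x}` (as a finset of unordered pairs). -/
def classEdges (s : Fin 5 → Equiv.Perm V) : Finset (Sym2 V) :=
  Finset.univ.biUnion fun i => Finset.univ.image fun x => s(x, s i x)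

/-- the `j`-th edge of the walk based at `x`. -/
def walkEdge (s : Fin 5 → Equiv.Perm V) (p : Fin 5 × V) : Sym2 V :=
  s(wv s p.1 p.2, wn s p.1 p.2)

theorem walkEdge_mem (s : Fin 5 → Equiv.Perm V) (p : Fin 5 × V) :
    walkEdge s p ∈ classEdges s := by
  obtain ⟨j, x⟩ := p
  simp only [classEdges, Finset.mem_biUnion, Finset.mem_univ, true_and, Finset.mem_image]
  fin_cases j
  · exact ⟨0, x, by simp [walkEdge, wv, wn]⟩
  · exact ⟨1, ((s 1)⁻¹ * s 0) x, by simp [walkEdge, wv, wn, Equiv.Perm.mul_apply]⟩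
  · exact ⟨2, ((s 1)⁻¹ * s 0) x, by simp [walkEdge, wv, wn, Equiv.Perm.mul_apply]⟩
  · exact ⟨3, ((s 3)⁻¹ * (s 2 * ((s 1)⁻¹ * s 0))) x, by simp [walkEdge, wv, wn, Equiv.Perm.mul_apply]⟩
  · exact ⟨4, ((s 3)⁻¹ * (s 2 * ((s 1)⁻¹ * s 0))) x, by simp [walkEdge, wv, wn, Equiv.Perm.mul_apply]⟩

/-- the walk edges exhaust the class edges. -/
theorem image_walkEdge (s : Fin 5 → Equiv.Perm V) :
    Finset.univ.image (walkEdge s) = classEdges s := by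
  ext e
  constructor
  · intro he
    obtain ⟨p, -, rfl⟩ := Finset.mem_image.mp he
    exact walkEdge_mem s p
  · intro he
    simp only [classEdges, Finset.mem_biUnion, Finset.mem_univ, true_and, Finset.mem_image] at he
    obtain ⟨i, y, rfl⟩ := he
    rw [Finset.mem_image]
    fin_cases i
    · exact ⟨(0, y), Finset.mem_univ _, by simp [walkEdge, wv, wn]⟩
    · exact ⟨(1, (s 0)⁻¹ (s 1 y)), Finset.mem_univ _, by simp [walkEdge, wv, wn, Equiv.Perm.mul_apply]⟩
    · exact ⟨(2, (s 0)⁻¹ (s 1 y)), Finset.mem_univ _, by simp [walkEdge, wv, wn, Equiv.Perm.mul_apply]⟩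
    · exact ⟨(3, (s 0)⁻¹ (s 1 ((s 2)⁻¹ (s 3 y)))), Finset.mem_univ _,
        by simp [walkEdge, wv, wn, Equiv.Perm.mul_apply]⟩
    · exact ⟨(4, (s 0)⁻¹ (s 1 ((s 2)⁻¹ (s 3 y)))), Finset.mem_univ _,
        by simp [walkEdge, wv, wn, Equiv.Perm.mul_apply]⟩

/-- distinctness of the `5|V|` class edges makes the walk-edge map injective. -/
theorem walkEdge_injective_of_card (s : Fin 5 → Equiv.Perm V)
    (hcard : (classEdges s).card = 5 * Fintype.card V) : Function.Injective (walkEdge s) := by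
  have h : Set.InjOn (walkEdge s) ↑(Finset.univ : Finset (Fin 5 × V)) := by
    apply Finset.card_image_iff.mp
    rw [image_walkEdge, hcard, Finset.card_univ, Fintype.card_prod, Fintype.card_fin]
  rwa [Finset.coe_univ, Set.injOn_univ] at h

/-- per-walk count: a closed 5-walk meeting `T` in `k` of its five vertex slots has at least `k - 2` edges inside `T`. -/
theorem walk_count_le (s : Fin 5 → Equiv.Perm V)
    (hclose : s 4 * ((s 3)⁻¹ * (s 2 * ((s 1)⁻¹ * s 0))) = 1) (T : Finset V) (x : V) :
    (Finset.univ.filter fun j : Fin 5 => wv s j x ∈ T).card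
      ≤ (Finset.univ.filter fun j : Fin 5 => wv s j x ∈ T ∧ wn s j x ∈ T).card + 2 := by
  have e0 : wn s 0 x = wv s 1 x := by simp [wv, wn]
  have e1 : wn s 1 x = wv s 2 x := by simp [wv, wn]
  have e2 : wn s 2 x = wv s 3 x := by simp [wv, wn]
  have e3 : wn s 3 x = wv s 4 x := by simp [wv, wn]
  have e4 : wn s 4 x = wv s 0 x := by simp [wv, wn, hclose]
  rw [Finset.card_filter, Finset.card_filter, Fin.sum_univ_five, Fin.sum_univ_five, e0, e1, e2, e3, e4]
  by_cases h0 : wv s 0 x ∈ T <;> by_cases h1 : wv s 1 x ∈ T <;> by_cases h2 : wv s 2 x ∈ T <;>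
    by_cases h3 : wv s 3 x ∈ T <;> by_cases h4 : wv s 4 x ∈ T <;> simp [h0, h1, h2, h3, h4]

/-- the five vertex maps are bijections, so the slots in `T` number `5|T|` in total. -/
theorem sum_walk_count (s : Fin 5 → Equiv.Perm V) (T : Finset V) :
    ∑ x, (Finset.univ.filter fun j : Fin 5 => wv s j x ∈ T).card = 5 * T.card := by
  have key : ∀ σ : Equiv.Perm V, (∑ x, if σ x ∈ T then 1 else 0) = T.card := by
    intro σ
    rw [show (∑ x, if σ x ∈ T then 1 else 0) = ∑ y, if y ∈ T then 1 else 0 from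
      Equiv.sum_comp σ (fun y => if y ∈ T then (1 : ℕ) else 0)]
    simp
  simp_rw [Finset.card_filter, Fin.sum_univ_five, Finset.sum_add_distrib, key]
  ring

/-- ZERO-SUM PENTAGON BOUND (non-abelian): closure + pairwise distinct walk edges ⇒ every `T` spans `≥ 5|T| - 2|V|`
class edges. -/
theorem zeroSum_pentagon_bound (s : Fin 5 → Equiv.Perm V)
    (hclose : s 4 * ((s 3)⁻¹ * (s 2 * ((s 1)⁻¹ * s 0))) = 1)
    (hinj : Function.Injective (walkEdge s)) (T : Finset V) :
    5 * (T.card : ℤ) - 2 * Fintype.card V ≤ (((classEdges s).filter fun e => ∀ v ∈ e, v ∈ T).card : ℤ) := by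
  set D : Finset (Fin 5 × V) :=
    Finset.univ.filter fun p => wv s p.1 p.2 ∈ T ∧ wn s p.1 p.2 ∈ T with hD
  have h1 : D.card ≤ ((classEdges s).filter fun e => ∀ v ∈ e, v ∈ T).card := by
    rw [← Finset.card_image_of_injective D hinj]
    apply Finset.card_le_card
    intro e he
    rw [Finset.mem_image] at he
    obtain ⟨p, hp, rfl⟩ := he
    rw [hD, Finset.mem_filter] at hp
    rw [Finset.mem_filter]
    refine ⟨walkEdge_mem s p, ?_⟩
    intro v hv
    rw [walkEdge, Sym2.mem_iff] at hv
    rcases hv with rfl | rfl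
    · exact hp.2.1
    · exact hp.2.2
  have hDsum : D.card = ∑ x, (Finset.univ.filter fun j : Fin 5 => wv s j x ∈ T ∧ wn s j x ∈ T).card := by
    rw [hD, Finset.card_filter, Fintype.sum_prod_type, Finset.sum_comm]
    simp_rw [Finset.card_filter]
  have h2 : 5 * T.card ≤ D.card + 2 * Fintype.card V := by
    rw [hDsum, ← sum_walk_count s T]
    have hle := Finset.sum_le_sum (s := Finset.univ) fun x _ => walk_count_le s hclose T x
    have hc : ∑ x : V, ((Finset.univ.filter fun j : Fin 5 => wv s j x ∈ T ∧ wn s j x ∈ T).card + 2)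
        = (∑ x : V, (Finset.univ.filter fun j : Fin 5 => wv s j x ∈ T ∧ wn s j x ∈ T).card)
          + 2 * Fintype.card V := by
      rw [Finset.sum_add_distrib]; simp [mul_comm]
    omega
  omega

end ZeroSum

/-! ### Translation tuples (the circulant case) and the kernel-checked half-density of `W₂₀(477691)` -/

section Translations

variable {A : Type*} [CommRing A] [Fintype A] [DecidableEq A]

/-- translation 5-tuple with steps `t j`. -/
def tr5 (t : Fin 5 → A) : Fin 5 → Equiv.Perm A := fun j => Equiv.addRight (t j)

omit [Fintype A] [DecidableEq A] in
theorem addRight_inv_apply (a x : A) : (Equiv.addRight a)⁻¹ x = x - a := by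
  rw [Equiv.Perm.inv_def, Equiv.symm_apply_eq]
  simp

/-- alternating zero sum of the steps ⇒ the translation walks close. -/
theorem tr5_close (t : Fin 5 → A) (h : t 0 - t 1 + t 2 - t 3 + t 4 = 0) :
    tr5 t 4 * ((tr5 t 3)⁻¹ * (tr5 t 2 * ((tr5 t 1)⁻¹ * tr5 t 0))) = 1 := by
  ext x
  simp only [tr5, Equiv.Perm.mul_apply, addRight_inv_apply, Equiv.coe_addRight, Equiv.Perm.coe_one, id_eq]
  linear_combination h

/-- `±`-distinct steps with `2 t j ≠ 0` give `5|A|` distinct class edges. -/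
theorem classEdges_tr5_card (t : Fin 5 → A)
    (hd : ∀ i j, i ≠ j → t i ≠ t j ∧ t i ≠ -t j) (h2 : ∀ i, t i + t i ≠ 0) :
    (classEdges (tr5 t)).card = 5 * Fintype.card A := by
  rw [classEdges, Finset.card_biUnion]
  · have hc : ∀ i, (Finset.univ.image fun x => s(x, tr5 t i x)).card = Fintype.card A := by
      intro i
      rw [Finset.card_image_of_injective _ ?_, Finset.card_univ]
      intro x y hxy
      simp only [tr5, Equiv.coe_addRight, Sym2.eq_iff] at hxy
      rcases hxy with ⟨h, _⟩ | ⟨h1, h3⟩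
      · exact h
      · exfalso; exact h2 i (by linear_combination h3 - h1)
    simp [hc]
  · intro i _ j _ hij
    dsimp only [Function.onFun]
    rw [Finset.disjoint_left]
    intro e hei hej
    simp only [Finset.mem_image, Finset.mem_univ, true_and, tr5, Equiv.coe_addRight] at hei hej
    obtain ⟨x, rfl⟩ := hei
    obtain ⟨y, hy⟩ := hej
    rw [Sym2.eq_iff] at hy
    rcases hy with ⟨h1, h3⟩ | ⟨h1, h3⟩
    · exact (hd i j hij).1 (by linear_combination h1 - h3)
    · exact (hd i j hij).2 (by linear_combination h3 - h1)

/-- class edges of two `±`-separated tuples are disjoint. -/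
theorem classEdges_tr5_disjoint (t t' : Fin 5 → A) (hd : ∀ i j, t i ≠ t' j ∧ t i ≠ -t' j) :
    Disjoint (classEdges (tr5 t)) (classEdges (tr5 t')) := by
  rw [Finset.disjoint_left]
  intro e he he'
  simp only [classEdges, Finset.mem_biUnion, Finset.mem_univ, true_and, Finset.mem_image, tr5,
    Equiv.coe_addRight] at he he'
  obtain ⟨i, x, rfl⟩ := he
  obtain ⟨j, y, hy⟩ := he'
  rw [Sym2.eq_iff] at hy
  rcases hy with ⟨h1, h3⟩ | ⟨h1, h3⟩
  · exact (hd i j).1 (by linear_combination h1 - h3)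
  · exact (hd i j).2 (by linear_combination h3 - h1)

end Translations

section W20Density

/-- the two step tuples of `W₂₀(477691)`: `bʲ` and `c bʲ`. -/
def tP : Fin 5 → ZMod Nw := ![1, bw, bw ^ 2, bw ^ 3, bw ^ 4]
def tC : Fin 5 → ZMod Nw := ![cw, cw * bw, cw * bw ^ 2, cw * bw ^ 3, cw * bw ^ 4]

theorem tP_close : tP 0 - tP 1 + tP 2 - tP 3 + tP 4 = 0 := by decide
theorem tC_close : tC 0 - tC 1 + tC 2 - tC 3 + tC 4 = 0 := by decide
theorem tP_dist : ∀ i j : Fin 5, i ≠ j → tP i ≠ tP j ∧ tP i ≠ -tP j := by decide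
theorem tC_dist : ∀ i j : Fin 5, i ≠ j → tC i ≠ tC j ∧ tC i ≠ -tC j := by decide
theorem tP_two : ∀ i : Fin 5, tP i + tP i ≠ 0 := by decide
theorem tC_two : ∀ i : Fin 5, tC i + tC i ≠ 0 := by decide
theorem tPC_dist : ∀ i j : Fin 5, tP i ≠ tC j ∧ tP i ≠ -tC j := by decide
theorem tP_mem : ∀ i : Fin 5, tP i ∈ w20S ∨ -tP i ∈ w20S := by decide
theorem tC_mem : ∀ i : Fin 5, tC i ∈ w20S ∨ -tC i ∈ w20S := by decide
theorem tP_ne : ∀ i : Fin 5, tP i ≠ 0 := by decide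
theorem tC_ne : ∀ i : Fin 5, tC i ≠ 0 := by decide

/-- class edges inside `T` are edges of the witness inside `T`. -/
theorem classEdges_subset_bobSide (t : Fin 5 → ZMod Nw) (hmem : ∀ i, t i ∈ w20S ∨ -t i ∈ w20S)
    (h0 : ∀ i, t i ≠ 0) (T : Finset (ZMod Nw)) :
    ((classEdges (tr5 t)).filter fun e => ∀ v ∈ e, v ∈ T) ⊆ bobSide T w20G.edgeFinset := by
  intro e he
  rw [Finset.mem_filter] at he
  rw [mem_bobSide]
  refine ⟨?_, he.2⟩
  obtain ⟨he1, -⟩ := he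
  simp only [classEdges, Finset.mem_biUnion, Finset.mem_univ, true_and, Finset.mem_image, tr5,
    Equiv.coe_addRight] at he1
  obtain ⟨i, x, rfl⟩ := he1
  rw [SimpleGraph.mem_edgeFinset, SimpleGraph.mem_edgeSet]
  simp only [w20G, circulantGraph, SimpleGraph.fromRel_adj, Finset.mem_coe]
  refine ⟨fun h => h0 i (by linear_combination -h), ?_⟩
  rcases hmem i with h | h
  · right; simpa using h
  · left; simpa using h

/-- KERNEL-CHECKED LINEAR EXCESS: every `≥ n/2`-set of `W₂₀(477691)` spans `> n` edges (in fact `≥ n + 5`). -/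
theorem w20LinearExcess_holds : W20LinearExcess := by
  intro T hT
  have hb1 := zeroSum_pentagon_bound (tr5 tP) (tr5_close tP tP_close)
    (walkEdge_injective_of_card _ (classEdges_tr5_card tP tP_dist tP_two)) T
  have hb2 := zeroSum_pentagon_bound (tr5 tC) (tr5_close tC tC_close)
    (walkEdge_injective_of_card _ (classEdges_tr5_card tC tC_dist tC_two)) T
  have hsub : ((classEdges (tr5 tP)).filter fun e => ∀ v ∈ e, v ∈ T) ∪
      ((classEdges (tr5 tC)).filter fun e => ∀ v ∈ e, v ∈ T) ⊆ bobSide T w20G.edgeFinset :=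
    Finset.union_subset (classEdges_subset_bobSide tP tP_mem tP_ne T)
      (classEdges_subset_bobSide tC tC_mem tC_ne T)
  have hdisj : Disjoint ((classEdges (tr5 tP)).filter fun e => ∀ v ∈ e, v ∈ T)
      ((classEdges (tr5 tC)).filter fun e => ∀ v ∈ e, v ∈ T) :=
    (classEdges_tr5_disjoint tP tC tPC_dist).mono (Finset.filter_subset _ _) (Finset.filter_subset _ _)
  have hcard := Finset.card_le_card hsub
  rw [Finset.card_union_of_disjoint hdisj] at hcard
  have hV : Fintype.card (ZMod Nw) = Nw := ZMod.card Nw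
  have hodd : Nw % 2 = 1 := by decide
  rw [hV] at hb1 hb2
  omega

end W20Density

end Summit.PneNP.PneNP.Cruxes.FoolingMeasure.SubgroupCirculants
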